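import Summits.Ventures.PercRepro.Night2LocalDQm1Lossy

/-!
# PercRepro — the regime `|E ∖ G| = q − 1`: the loss bound with one layer-0 preimage, every `q` (night-2, gen 17)

Sequel of `Night2LocalDQm1Lossy.lean`.  At `d = q − 1` a layer-1 request is at most `Φ/(q+1)` and a covering set with
`k1` layer-0 preimages has `L1 ≤ (q+1−k1)·Φ/(q+1)` (`L1_le_dqm1`) and capacity `1 − k1·Φ/q`; the loss of a member at
such a covering set is at most `(Φ/(q+1))·(L_max − cap)/L_max` (`loss_le_dqm1`), which evaluates to `1/(q+1)²` at
`k1 = 0` (Theorem F's bound) and to `(q² + 2q + 2)/(q²(q+1)²)` at `k1 = 1` (`loss_le_dqm1_one`; at `q = 4` this is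
`13/48` of the request `6/25`, NIGHT-2-dq3.md §4.2).  Paper: proofs/NIGHT-2-g17.md §3.5.
-/

open scoped Matroid

namespace PercRepro.Shadow

open Finset PerFlat ThmH

variable {α : Type*} [DecidableEq α] {M : Matroid α} [M.Finite]

section LossBound

variable {q : ℕ} {G : Finset α}

open scoped Classical in
/-- At `d = q − 1`: `L1 S ≤ (q + 1 − k1 S) · Φ/(q+1)` at every shadow set. -/
theorem L1_le_dqm1 (hG : G ∈ flatsQ M (q + 1)) {d : ℕ} (hd : (gr M \ G).card = d) (hdq : d + 1 = q)
    {S : Finset α} (hS : S ∈ shadowAt M (q + 2) q (Uq M (q + 2) q) G) :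
    L1 M q G S ≤ (((q : ℚ) + 1) - (k1 M q G S : ℚ)) * (phiQ q / ((q : ℚ) + 1)) := by
  have hL := L1_le_card_thin_mul hG hd (by omega) S
  rw [phiQ_div_two_add_pred hdq] at hL
  refine hL.trans ?_
  apply mul_le_mul_of_nonneg_right _ (by have := phiQ_pos q; positivity)
  have := card_thin_preimages_le hS
  have h' : (((coverPreimages M (Uq M (q + 2) q) G S).filter (fun B => B ∉ lay0 M q G)).card : ℚ) +
      (k1 M q G S : ℚ) ≤ (q : ℚ) + 1 := by exact_mod_cast this
  linarith

open scoped Classical in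
/-- **The loss bound at `d = q − 1`**: with `k1` layer-0 preimages at the covering set `B ∪ {z}`,
`loss ≤ (Φ/(q+1)) · (L_max − cap)/L_max`, `L_max = (q+1−k1)·Φ/(q+1)`, `cap = 1 − k1·Φ/q`. -/
theorem loss_le_dqm1 (hG : G ∈ flatsQ M (q + 1)) {d : ℕ} (hd : (gr M \ G).card = d) (hdq : d + 1 = q)
    {B : Finset α} (hB : B ∈ membersIn M (Uq M (q + 2) q) G) (hB0 : B ∉ lay0 M q G) {z : α}
    (hz : z ∈ G \ clF M B) :
    loss M q G B z ≤ (phiQ q / ((q : ℚ) + 1)) *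
      (((((q : ℚ) + 1) - (k1 M q G (insert z B) : ℚ)) * (phiQ q / ((q : ℚ) + 1)) -
          (1 - (k1 M q G (insert z B) : ℚ) * phiQ q / (q : ℚ))) /
        ((((q : ℚ) + 1) - (k1 M q G (insert z B) : ℚ)) * (phiQ q / ((q : ℚ) + 1)))) := by
  have hS : insert z B ∈ shadowAt M (q + 2) q (Uq M (q + 2) q) G :=
    insert_mem_shadowAt (Finset.Subset.refl _) hG hB hz
  have hSG : insert z B ⊆ G := subset_of_mem_shadowAt hS
  have hk_nat : k1 M q G (insert z B) ≤ d := hd ▸ k1_le hG hSG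
  set S := insert z B with hSdef
  set k := k1 M q G S with hkdef
  have hq1 : (0 : ℚ) < (q : ℚ) + 1 := by positivity
  have hphi := phiQ_pos q
  have hqk : (0 : ℚ) < ((q : ℚ) + 1) - (k : ℚ) := by
    have : (k : ℚ) ≤ (d : ℚ) := by exact_mod_cast hk_nat
    have : (d : ℚ) + 1 = (q : ℚ) := by exact_mod_cast hdq
    linarith
  have hLmax : (0 : ℚ) < (((q : ℚ) + 1) - (k : ℚ)) * (phiQ q / ((q : ℚ) + 1)) := by positivity
  have hcapS : capS M q G S = 1 - (k : ℚ) * phiQ q / (q : ℚ) := by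
    unfold capS
    rw [hd]
    have : (1 : ℚ) + (d : ℚ) = (q : ℚ) := by exact_mod_cast (by omega : 1 + d = q)
    rw [this]
  have hcap0 : 0 ≤ capS M q G S := capS_nonneg hG (by omega) hSG
  have hreq : req M q B ≤ phiQ q / ((q : ℚ) + 1) := by
    have := req_le_of_not_lay0 hG hd (by omega) hB hB0
    rwa [phiQ_div_two_add_pred hdq] at this
  have hL1 : L1 M q G S ≤ (((q : ℚ) + 1) - (k : ℚ)) * (phiQ q / ((q : ℚ) + 1)) := L1_le_dqm1 hG hd hdq hS
  have hq0 : (0 : ℚ) < (q : ℚ) := by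
    have : (1 : ℚ) ≤ (q : ℚ) := by exact_mod_cast (by omega : 1 ≤ q)
    linarith
  have hgap : (((q : ℚ) + 1) - (k : ℚ)) * (phiQ q / ((q : ℚ) + 1)) - (1 - (k : ℚ) * phiQ q / (q : ℚ)) =
      ((q : ℚ) * ((q : ℚ) + 1) + (k : ℚ) * ((q : ℚ) + 2)) / ((q : ℚ) * ((q : ℚ) + 1) ^ 2) := by
    unfold phiQ
    field_simp
    ring
  have hgap0 : 0 ≤ (((q : ℚ) + 1) - (k : ℚ)) * (phiQ q / ((q : ℚ) + 1)) - (1 - (k : ℚ) * phiQ q / (q : ℚ)) := by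
    rw [hgap]; positivity
  have hrhs : 0 ≤ (phiQ q / ((q : ℚ) + 1)) *
      (((((q : ℚ) + 1) - (k : ℚ)) * (phiQ q / ((q : ℚ) + 1)) - (1 - (k : ℚ) * phiQ q / (q : ℚ))) /
        ((((q : ℚ) + 1) - (k : ℚ)) * (phiQ q / ((q : ℚ) + 1)))) := by
    apply mul_nonneg (by positivity)
    exact div_nonneg hgap0 hLmax.le
  unfold loss fS
  split_ifs with hle
  · rw [sub_self, mul_zero]; exact hrhs
  · push Not at hle
    have hLpos : 0 < L1 M q G S := hcap0.trans_lt hle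
    have h1 : 1 - capS M q G S / L1 M q G S = (L1 M q G S - capS M q G S) / L1 M q G S := by
      field_simp
    rw [h1]
    calc req M q B * ((L1 M q G S - capS M q G S) / L1 M q G S)
        ≤ (phiQ q / ((q : ℚ) + 1)) * ((L1 M q G S - capS M q G S) / L1 M q G S) := by
          apply mul_le_mul_of_nonneg_right hreq
          exact div_nonneg (by linarith) hLpos.le
      _ ≤ (phiQ q / ((q : ℚ) + 1)) *
          (((((q : ℚ) + 1) - (k : ℚ)) * (phiQ q / ((q : ℚ) + 1)) - capS M q G S) /
            ((((q : ℚ) + 1) - (k : ℚ)) * (phiQ q / ((q : ℚ) + 1)))) := by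
          apply mul_le_mul_of_nonneg_left _ (by positivity)
          exact ratio_mono hcap0 hLpos hL1
      _ = _ := by rw [hcapS]

/-- The bound of `loss_le_dqm1` at `k1 = 0` is `1/(q+1)²`. -/
theorem lossBound_dqm1_zero (q : ℕ) (hq : 1 ≤ q) :
    (phiQ q / ((q : ℚ) + 1)) *
      (((((q : ℚ) + 1) - ((0 : ℕ) : ℚ)) * (phiQ q / ((q : ℚ) + 1)) - (1 - ((0 : ℕ) : ℚ) * phiQ q / (q : ℚ))) /
        ((((q : ℚ) + 1) - ((0 : ℕ) : ℚ)) * (phiQ q / ((q : ℚ) + 1)))) = 1 / (((q : ℚ) + 1) ^ 2) := by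
  have hq0 : (0 : ℚ) < (q : ℚ) := by exact_mod_cast hq
  have hqne : (q : ℚ) ≠ 0 := hq0.ne'
  have hq1ne : (q : ℚ) + 1 ≠ 0 := by positivity
  unfold phiQ
  push_cast
  simp only [sub_zero, zero_mul, zero_div]
  field_simp
  ring

/-- The bound of `loss_le_dqm1` at `k1 = 1` is `(q² + 2q + 2)/(q²(q+1)²)`. -/
theorem lossBound_dqm1_one (q : ℕ) (hq : 2 ≤ q) :
    (phiQ q / ((q : ℚ) + 1)) *
      (((((q : ℚ) + 1) - ((1 : ℕ) : ℚ)) * (phiQ q / ((q : ℚ) + 1)) - (1 - ((1 : ℕ) : ℚ) * phiQ q / (q : ℚ))) /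
        ((((q : ℚ) + 1) - ((1 : ℕ) : ℚ)) * (phiQ q / ((q : ℚ) + 1)))) =
      ((q : ℚ) ^ 2 + 2 * (q : ℚ) + 2) / ((q : ℚ) ^ 2 * ((q : ℚ) + 1) ^ 2) := by
  have hq0 : (0 : ℚ) < (q : ℚ) := by
    have : (2 : ℚ) ≤ (q : ℚ) := by exact_mod_cast hq
    linarith
  have hqne : (q : ℚ) ≠ 0 := hq0.ne'
  have hq1ne : (q : ℚ) + 1 ≠ 0 := by positivity
  unfold phiQ
  push_cast
  simp only [add_sub_cancel_right, one_mul]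
  field_simp
  ring

open scoped Classical in
/-- **The loss bound at `d = q − 1` without a layer-0 preimage**: `loss ≤ 1/(q+1)²`. -/
theorem loss_le_dqm1_of_k1_eq_zero (hG : G ∈ flatsQ M (q + 1)) {d : ℕ} (hd : (gr M \ G).card = d)
    (hdq : d + 1 = q) {B : Finset α} (hB : B ∈ membersIn M (Uq M (q + 2) q) G) (hB0 : B ∉ lay0 M q G) {z : α}
    (hz : z ∈ G \ clF M B) (hk1 : k1 M q G (insert z B) = 0) :
    loss M q G B z ≤ 1 / (((q : ℚ) + 1) ^ 2) := by
  have h := loss_le_dqm1 hG hd hdq hB hB0 hz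
  rw [hk1] at h
  rwa [lossBound_dqm1_zero q (by omega)] at h

open scoped Classical in
/-- **The loss bound at `d = q − 1` with ONE layer-0 preimage**: `loss ≤ (q² + 2q + 2)/(q²(q+1)²)`. -/
theorem loss_le_dqm1_of_k1_eq_one (hG : G ∈ flatsQ M (q + 1)) {d : ℕ} (hd : (gr M \ G).card = d)
    (hdq : d + 1 = q) (hq : 2 ≤ q) {B : Finset α} (hB : B ∈ membersIn M (Uq M (q + 2) q) G)
    (hB0 : B ∉ lay0 M q G) {z : α} (hz : z ∈ G \ clF M B) (hk1 : k1 M q G (insert z B) = 1) :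
    loss M q G B z ≤ ((q : ℚ) ^ 2 + 2 * (q : ℚ) + 2) / ((q : ℚ) ^ 2 * ((q : ℚ) + 1) ^ 2) := by
  have h := loss_le_dqm1 hG hd hdq hB hB0 hz
  rw [hk1] at h
  rwa [lossBound_dqm1_one q hq] at h

end LossBound

end PercRepro.Shadow
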